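import Literature.NumberTheory.Automorphic.ParabolicGLBigCell
import Literature.NumberTheory.Automorphic.SmoothInductionCyclic
import Literature.NumberTheory.Automorphic.ParabolicGLExactProofs
import Literature.NumberTheory.Automorphic.RestrictedTensorProductIrreducibleProofs
import HarnessLib

/-!
# Parabolic induction of an irreducible admissible representation of `GL_n(F)` is finitely generated

Second step of this seat's proof of the named fact `Representation.isFiniteLength_parabolicIndGL`
(parabolic induction on `GL_n(F)` preserves finite length; Bernstein–Zelevinsky 1977, Thm. 2.8
with Remark 2.10; Zelevinsky 1980, Prop. 1.4). After the reduction to irreducible admissible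
inducing data (`ParabolicIndGLFiniteLengthReduction`), one needs that `i_c ω` is a finitely
generated `ℂ[GL_n(F)]`-module for `ω` irreducible admissible; finite length then follows from
"finitely generated admissible representations have finite length" (the remaining steps).

`Representation.finite_asModule_parabolicIndGL_of_isIrreducible`: for a monotone block labelling
`c : Fin n → Fin r` and an irreducible admissible representation `ω` of the Levi `Π_a GL_{n_a}(F)`,
the normalised induced representation `i_c ω` is a finitely generated (indeed cyclic)
`ℂ[GL_n(F)]`-module. This is Bernstein–Zelevinsky 1976, §3.13 (c) (for `GL_n`: the functor `i`
carries finitely generated representations into finitely generated ones) in the irreducible case,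
proved by the abstract big-cell argument `Representation.finite_asModule_smoothInd_of_bigCellDatum`
(`SmoothInductionCyclic`) applied to the big-cell datum of `P_c` (`ParabolicGLBigCell`), with

* Schur's lemma (`Representation.IsAdmissible.exists_eq_smul_id`, compact open subgroup
  `Π_a GL(B_a, 𝒪)` of the Levi): the contracting block-scalar torus elements `diag(ϖ^{g c(i)})` are
  central in the Levi (`leviZpowDiag_mem_center`), hence act on `ω` by scalars, and `δ_{P_c}^{1/2}`
  is a scalar anyway;
* irreducibility: the `M_c`-orbit of any `w₀ ≠ 0` spans `W` (`orbitCombination_surjective`);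
* smoothness of `ω ∘ proj ⊗ δ^{1/2}` (`IsSmooth.twist_comp_leviProjection`), which provides a level
  `j₀` with `w₀ ∈ W^{τ(P_c ∩ K_{j₀})}`.

Theorems only; no definitions, no named facts.

## References

* I. N. Bernstein, A. V. Zelevinsky, *Representations of the group `GL(n, F)` where `F` is a
  non-archimedean local field*, Russian Math. Surveys 31:3 (1976), §3.13.
* I. N. Bernstein, A. V. Zelevinsky, *Induced representations of reductive `p`-adic groups I*,
  Ann. Sci. ÉNS 10 (1977), Prop. 2.3, p. 446.
* A. V. Zelevinsky, *Induced representations of reductive `p`-adic groups II*, Ann. Sci. ÉNS 13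
  (1980), proof of Prop. 1.4, p. 171.
-/

noncomputable section

open scoped MatrixGroups
open ValuativeRel OrderDual Topology

namespace Representation

open Literature.NumberTheory.Automorphic

variable {F : Type*} [Field F] [ValuativeRel F] [TopologicalSpace F] [IsNonarchimedeanLocalField F]
  {n r : ℕ} {c : Fin n → Fin r} {W : Type*} [AddCommGroup W] [Module ℂ W]

omit [ValuativeRel F] [IsNonarchimedeanLocalField F] in
/-- A vector of a smooth representation of `P_c` is fixed by `τ(P_c ∩ K)` for every sufficiently
small subgroup `K` of a big-cell datum: the open stabiliser of `w` in `P_c` contains `P_c ∩ U`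
for a neighbourhood `U` of `1` in `GL_n(F)`. [folklore] -/
theorem exists_mem_fixedByLevel (𝒟 : BigCellDatum (standardParabolicGL F c))
    {τ : Representation ℂ (standardParabolicGL F c) W} (hτ : τ.IsSmooth) (w : W) :
    ∃ j : ℕ, w ∈ fixedByLevel 𝒟 τ j := by
  have hopen : IsOpen ((τ.stabilizerSubgroup w : Set (standardParabolicGL F c))) := hτ w
  obtain ⟨U, hUo, hU⟩ := isOpen_induced_iff.1 hopen
  have h1 : U ∈ 𝓝 (1 : GL (Fin n) F) := by
    refine hUo.mem_nhds ?_
    have : (1 : standardParabolicGL F c) ∈ Subtype.val ⁻¹' U := by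
      rw [hU]
      exact Subgroup.one_mem _
    exact this
  obtain ⟨j, hj⟩ := 𝒟.exists_K_subset U h1
  refine ⟨j, fun p hp => ?_⟩
  have : p ∈ (τ.stabilizerSubgroup w : Set (standardParabolicGL F c)) := by
    rw [← hU]
    exact hj hp
  exact this

/-- **`i_c ω` is finitely generated for `ω` irreducible admissible** (Bernstein–Zelevinsky 1976,
§3.13 (c), irreducible case; the input "`i` preserves finite generation" of Zelevinsky 1980,
Prop. 1.4 / Bernstein–Zelevinsky 1977, Thm. 2.8): for a monotone block labelling
`c : Fin n → Fin r` of `GL_n(F)`, `F` a non-archimedean local field, and an irreducible admissible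
representation `ω` of `Π_a GL_{n_a}(F)`, the `ℂ[GL_n(F)]`-module of
`i_c ω = Ind_{P_c}^{GL_n(F)} (ω ∘ proj ⊗ δ^{1/2})` is finitely generated (generated by one standard
vector `φ_{K_{j₀}, w₀}`). [cite: BernsteinZelevinsky1976, §3.13] -/
theorem finite_asModule_parabolicIndGL_of_isIrreducible (hc : Monotone c)
    (ω : Representation ℂ (Π a, GL {i // c i = a} F) W) [ω.IsIrreducible] (hω : ω.IsAdmissible) :
    Module.Finite (MonoidAlgebra ℂ (GL (Fin n) F)) (parabolicIndGL F c ω).asModule := by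
  -- the datum
  obtain ⟨ϖ, hϖ0, hϖ1⟩ := exists_valuation_pos_lt_one (F := F)
  set 𝒟 := bigCellDatumGL hc hϖ0 hϖ1 with h𝒟
  set τ : Representation ℂ (standardParabolicGL F c) W :=
    Representation.twist (ω.comp (leviProjection F c)) (rootDeltaChar (standardParabolicGL F c)) with hτ
  have hτs : τ.IsSmooth := hω.isSmooth.twist_comp_leviProjection F c
  -- a non-zero vector and its level
  haveI : Nontrivial W := IsIrreducible.nontrivial ω
  obtain ⟨w₀, hw₀0⟩ := exists_ne (0 : W)
  obtain ⟨j₀, hw₀⟩ := exists_mem_fixedByLevel 𝒟 hτs w₀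
  -- `τ` on Levi elements
  have hτM : ∀ (g : Π a, GL {i // c i = a} F) (hg : blockDiagonalGL F c g ∈ standardParabolicGL F c)
      (w : W), τ ⟨blockDiagonalGL F c g, hg⟩ w =
        ((rootDeltaChar (standardParabolicGL F c) ⟨blockDiagonalGL F c g, hg⟩ : ℂˣ) : ℂ) • ω g w := by
    intro g hg w
    rw [hτ, twist_apply]
    congr 2
    rw [MonoidHom.comp_apply,
      show leviProjection F c ⟨blockDiagonalGL F c g, hg⟩ = g from leviProjection_leviEmbeddingP_apply c g]
  change Module.Finite (MonoidAlgebra ℂ (GL (Fin n) F)) (smoothIndRep (standardParabolicGL F c) τ).asModule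
  refine finite_asModule_smoothInd_of_bigCellDatum 𝒟 τ hw₀ hw₀0 (fun t ht => ?_) (fun v => ?_)
  · -- contracting elements act by scalars (Schur)
    obtain ⟨g, rfl⟩ := (mem_bigCellDatumGL_Z_iff hc hϖ0 hϖ1).1 ht
    set e : Fin n → ℤ := fun i => (g : ℤ) * (c i : ℕ) with he
    set lz := leviZpowDiag c ((Valuation.ne_zero_iff _).1 hϖ0) e with hlz
    have hcen : lz ∈ Subgroup.center (Π a, GL {i // c i = a} F) :=
      leviZpowDiag_mem_center c _ fun i j hij => by simp [he, hij]
    obtain ⟨χ, hχ⟩ := hω.exists_eq_smul_id (isOpen_leviIntegral F c) (isCompact_leviIntegral F c)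
      (ω lz) fun g' => by
        rw [← Module.End.mul_eq_comp, ← Module.End.mul_eq_comp, ← map_mul, ← map_mul,
          Subgroup.mem_center_iff.1 hcen g']
    have ht' : zpowDiagGL ((Valuation.ne_zero_iff _).1 hϖ0) e = blockDiagonalGL F c lz := by
      rw [hlz, blockDiagonalGL_leviZpowDiag]
    have hmem : blockDiagonalGL F c lz ∈ standardParabolicGL F c := blockDiagonalGL_mem c lz
    refine ⟨((rootDeltaChar (standardParabolicGL F c) ⟨blockDiagonalGL F c lz, hmem⟩ : ℂˣ) : ℂ) * χ, ?_⟩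
    have : (⟨zpowDiagGL ((Valuation.ne_zero_iff _).1 hϖ0) e, 𝒟.M_le (𝒟.Z_subset ht)⟩ :
        standardParabolicGL F c) = ⟨blockDiagonalGL F c lz, hmem⟩ := Subtype.ext ht'
    rw [this, hτM lz hmem w₀, hχ, LinearMap.smul_apply, LinearMap.id_apply, smul_smul]
  · -- the `M_c`-orbit of `w₀` spans
    obtain ⟨f, rfl⟩ := orbitCombination_surjective (ρ := ω) hw₀0 v
    rw [orbitCombination, Finsupp.linearCombination_apply]
    refine Submodule.sum_mem _ fun g _ => Submodule.smul_mem _ _ ?_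
    have hmem : blockDiagonalGL F c g ∈ standardParabolicGL F c := blockDiagonalGL_mem c g
    have hM : blockDiagonalGL F c g ∈ 𝒟.M := ⟨g, rfl⟩
    have hunit : ((rootDeltaChar (standardParabolicGL F c) ⟨blockDiagonalGL F c g, hmem⟩ : ℂˣ) : ℂ) ≠ 0 :=
      Units.ne_zero _
    have key : ω g w₀ = ((rootDeltaChar (standardParabolicGL F c) ⟨blockDiagonalGL F c g, hmem⟩ : ℂˣ) : ℂ)⁻¹ •
        τ ⟨blockDiagonalGL F c g, 𝒟.M_le hM⟩ w₀ := by
      rw [hτM g hmem w₀, smul_smul, inv_mul_cancel₀ hunit, one_smul]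
    rw [key]
    exact Submodule.smul_mem _ _ (Submodule.subset_span ⟨⟨blockDiagonalGL F c g, hM⟩, rfl⟩)

end Representation
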